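/-
COR-CM (cell pub-hodgecm2, stage 2 of the Hodge ladder) — count-neutral KERNEL COMBINATORICS «split index-two descent, II: the residual circulations —
a tracked descent engine and the vanishing lemma» (seat prover-pub-hodgecm2-b23-g46-0, binder prover b23, gen 46; claim «SPLIT INDEX-TWO»,
HOME/INBOX.md l.20957).  Theorems only, on top of `Census/IndexTwoSplitDistance` BY NAME; no `decide`, no certificate, no named fact, no `sorry`;
`Interfaces.lean` (C1), every E term, B01, `Transposition/*`, `PortJoin/*`, `D2Bridge/*` untouched.
HONEST FRAMING: `HC_CM` is NOT proved, here or anywhere in the tree; nothing here is a period, a count of record or a headline.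
T5: n/a-class (hypothesis binders: `c * c = 1`, `c` central, `c ∈ H`, `H.index = 2`, `x ∉ H`); checker: self.
-/
import Summits.HodgeConjecture.CorCM.Census.IndexTwoSplitDistance

/-!
# Split index-two descent, II: residual circulations — engine and vanishing lemma

Setting of `Census/IndexTwoSplitDistance.lean`.  After the distance descent, what is left of the bi-marginal-zero lattice `Z` lives on the
RESIDUAL types: the DIAGONAL types `(Φ, Φ)` (distance `0`) and the NEIGHBOUR types `(Φ, Φ^{(t)})` (distance `1`) — the vertices and the arcs of
the bidirected cube on the types of `(H, c)`; `marg₀ = 0` / `marg₁ = 0` are the out-flow and in-flow conditions of a CIRCULATION.  This part supplies the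
two generic tools for the structure theorem of part III (circulations = two-cycle faces + square elements):

* §1 coordinates of the marginals: `(marg₀ y) T = Σ_{Θ : res₀ Θ = T} y Θ`, `(marg₁ y) T = Σ_{Θ : res₁ Θ = T} y Θ` (`marg₀_apply_eq_sum`,
  `marg₁_apply_eq_sum`);
* §2 a **TRACKED POTENTIAL DESCENT** (`tracked_descent`): b09ʼs `TwistGeneration.descent` with arbitrary relation vectors `[Ψ] + w` (not only
  faces) and an invariant support predicate `Keep` — modulo `L` every vector supported in `Keep` is congruent to one supported in `Keep ∧ Res`;
* §3 **THE VANISHING LEMMA** (`eq_zero_of_supported_canonical`): fix a base type `T₀` of `(H, c)` and for every type `a ≠ T₀` a CANONICAL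
  deviation `κ a ∈ T₀ ∖ a`; a bi-marginal-zero vector supported on diagonal types and CANONICAL DOWN-ARCS `(a, a^{(κ a)})` only is `0`
  (look at a heaviest vertex `a`: its in-flow is `z(a,a)` alone, its out-flow `z(a,a) + z(a, a^{(κ a)})`).

## References
* [Pohlmann1968] H. Pohlmann, Algebraic cycles on abelian varieties of complex multiplication type, Ann. of Math. 88 (1968), Thm 1.
-/

namespace Summit.HodgeConjecture.CorCM.Census.IndexTwoDescent

open Finset
open Summit.HodgeConjecture.CorCM.Prior.AllgGroup.RfwfAllgGroup
open Summit.HodgeConjecture.CorCM.Census.BlockParity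
open Summit.HodgeConjecture.CorCM.Census.Coinvariant
open Summit.HodgeConjecture.CorCM.Census.ComplementFaces

noncomputable section

variable {G : Type*} [Group G] [Fintype G] [DecidableEq G] {c : G}
variable {H : Subgroup G} [DecidablePred (· ∈ H)]

/-! ## §1 Coordinates of the marginals -/

omit [DecidablePred (· ∈ H)] in
/-- Coordinates of a push-forward: `(f_* y) T = Σ_{Θ ∈ supp y, f Θ = T} y Θ`. [folklore] -/
theorem mapDomain_apply_eq_sum {α β : Type*} [DecidableEq β] (f : α → β) (y : α →₀ ℤ) (T : β) :
    Finsupp.mapDomain f y T = ∑ Θ ∈ y.support, if f Θ = T then y Θ else 0 := by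
  rw [Finsupp.mapDomain, Finsupp.sum_apply, Finsupp.sum]
  refine Finset.sum_congr rfl fun Θ _ => ?_
  rw [Finsupp.single_apply]

/-- `(marg₀ y) T = Σ_{Θ ∈ supp y, res₀ Θ = T} y Θ`. [folklore] -/
theorem marg₀_apply_eq_sum (hcH : c ∈ H) (y : CMF G c →₀ ℤ) (T : CMF H ⟨c, hcH⟩) :
    marg₀ hcH y T = ∑ Θ ∈ y.support, if res₀ hcH Θ = T then y Θ else 0 := by
  rw [marg₀, Finsupp.lmapDomain_apply, mapDomain_apply_eq_sum]

/-- `(marg₁ y) T = Σ_{Θ ∈ supp y, res₁ Θ = T} y Θ`. [folklore] -/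
theorem marg₁_apply_eq_sum (hcH : c ∈ H) (hcen : ∀ g : G, g * c = c * g) (x : G) (y : CMF G c →₀ ℤ) (T : CMF H ⟨c, hcH⟩) :
    marg₁ hcH hcen x y T = ∑ Θ ∈ y.support, if res₁ hcH hcen x Θ = T then y Θ else 0 := by
  rw [marg₁, Finsupp.lmapDomain_apply, mapDomain_apply_eq_sum]

/-! ## §2 A tracked potential descent -/

section Engine

variable (P : CMF G c → ℕ) (Res Keep : CMF G c → Prop)

omit [DecidablePred (· ∈ H)] in
/-- One clearing step of the tracked descent. [folklore] -/
theorem tracked_clear_step (L : Submodule ℤ (CMF G c →₀ ℤ))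
    (hL : ∀ Ψ : CMF G c, Keep Ψ → ¬ Res Ψ → ∃ v ∈ L, ∃ w : CMF G c →₀ ℤ,
      (∀ Φ : CMF G c, w Φ ≠ 0 → Keep Φ ∧ P Φ < P Ψ) ∧ v = Finsupp.single Ψ 1 + w)
    (k : ℕ) (y : CMF G c →₀ ℤ) (hyK : ∀ Ψ ∈ y.support, Keep Ψ) (hy : ∀ Ψ ∈ y.support, Res Ψ ∨ P Ψ < k + 1) :
    ∃ y' : CMF G c →₀ ℤ, y - y' ∈ L ∧ (∀ Ψ ∈ y'.support, Keep Ψ) ∧ ∀ Ψ ∈ y'.support, Res Ψ ∨ P Ψ < k := by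
  classical
  have hF : ∀ Ψ : CMF G c, Keep Ψ ∧ ¬ Res Ψ → ∃ v : CMF G c →₀ ℤ, v ∈ L ∧ ∃ w : CMF G c →₀ ℤ,
      (∀ Φ : CMF G c, w Φ ≠ 0 → Keep Φ ∧ P Φ < P Ψ) ∧ v = Finsupp.single Ψ 1 + w := fun Ψ h => by
    obtain ⟨v, hv, w, hw, hvw⟩ := hL Ψ h.1 h.2
    exact ⟨v, hv, w, hw, hvw⟩
  choose! F hFmem W hW hFeq using hF
  set Bk : Finset (CMF G c) := y.support.filter fun Ψ => ¬ Res Ψ ∧ P Ψ = k with hBk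
  have hBkKeep : ∀ Ψ ∈ Bk, Keep Ψ ∧ ¬ Res Ψ := fun Ψ hΨ =>
    ⟨hyK Ψ (Finset.mem_filter.mp hΨ).1, (Finset.mem_filter.mp hΨ).2.1⟩
  set q : CMF G c →₀ ℤ := ∑ Ψ ∈ Bk, y Ψ • F Ψ with hq
  have hqmem : q ∈ L := Submodule.sum_mem _ fun Ψ hΨ => Submodule.smul_mem _ _ (hFmem Ψ (hBkKeep Ψ hΨ))
  -- value of `q` at a type `Φ`: the `[Ψ]`-parts contribute `y Φ` iff `Φ ∈ Bk`; the `w`-parts vanish unless `Keep Φ ∧ P Φ < k`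
  have hqval : ∀ Φ : CMF G c, ¬ (Keep Φ ∧ P Φ < k) → q Φ = if Φ ∈ Bk then y Φ else 0 := by
    intro Φ hΦ
    rw [hq, Finsupp.finsetSum_apply]
    have hterm : ∀ Ψ ∈ Bk, (y Ψ • F Ψ) Φ = if Φ = Ψ then y Ψ else 0 := by
      intro Ψ hΨ
      obtain ⟨-, -, hΨk⟩ := Finset.mem_filter.mp hΨ
      have hWz : W Ψ Φ = 0 := by
        by_contra h
        have := hW Ψ (hBkKeep Ψ hΨ) Φ h
        exact hΦ ⟨this.1, by omega⟩
      rw [Finsupp.smul_apply, smul_eq_mul, hFeq Ψ (hBkKeep Ψ hΨ), Finsupp.add_apply, hWz, add_zero, Finsupp.single_apply]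
      by_cases h : Ψ = Φ
      · rw [if_pos h, if_pos h.symm, mul_one]
      · rw [if_neg h, if_neg (fun h' => h h'.symm), mul_zero]
    rw [Finset.sum_congr rfl hterm, Finset.sum_ite_eq]
  refine ⟨y - q, by rw [sub_sub_cancel]; exact hqmem, fun Φ hΦ => ?_, fun Φ hΦ => ?_⟩
  · -- Keep is preserved
    by_contra hK
    rw [Finsupp.mem_support_iff, Finsupp.sub_apply, hqval Φ (fun h => hK h.1)] at hΦ
    by_cases hB : Φ ∈ Bk
    · rw [if_pos hB, sub_self] at hΦ; exact hΦ rfl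
    · rw [if_neg hB, sub_zero] at hΦ
      exact hK (hyK Φ (Finsupp.mem_support_iff.mpr hΦ))
  · by_contra hbad
    push Not at hbad
    obtain ⟨hΦ1, hΦk⟩ := hbad
    rw [Finsupp.mem_support_iff, Finsupp.sub_apply, hqval Φ (fun h => by omega)] at hΦ
    by_cases hB' : Φ ∈ Bk
    · rw [if_pos hB', sub_self] at hΦ; exact hΦ rfl
    · rw [if_neg hB', sub_zero] at hΦ
      have hsupp : Φ ∈ y.support := Finsupp.mem_support_iff.mpr hΦ
      rcases hy Φ hsupp with h | h
      · exact hΦ1 h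
      · exact hB' (Finset.mem_filter.mpr ⟨hsupp, hΦ1, by omega⟩)

omit [DecidablePred (· ∈ H)] in
/-- **TRACKED POTENTIAL DESCENT.**  Let `L` hold, through every type `Ψ` with `Keep Ψ` and `¬ Res Ψ`, a relation `[Ψ] + w ∈ L` whose other terms
are `Keep`-types of smaller potential.  Then every vector supported in `Keep` is congruent modulo `L` to one supported in `Keep ∧ Res`. [folklore] -/
theorem tracked_descent (L : Submodule ℤ (CMF G c →₀ ℤ))
    (hL : ∀ Ψ : CMF G c, Keep Ψ → ¬ Res Ψ → ∃ v ∈ L, ∃ w : CMF G c →₀ ℤ,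
      (∀ Φ : CMF G c, w Φ ≠ 0 → Keep Φ ∧ P Φ < P Ψ) ∧ v = Finsupp.single Ψ 1 + w)
    (y : CMF G c →₀ ℤ) (hyK : ∀ Ψ ∈ y.support, Keep Ψ) :
    ∃ y' : CMF G c →₀ ℤ, y - y' ∈ L ∧ (∀ Ψ ∈ y'.support, Keep Ψ) ∧ ∀ Ψ ∈ y'.support, Res Ψ := by
  classical
  suffices h : ∀ k : ℕ, ∀ y : CMF G c →₀ ℤ, (∀ Ψ ∈ y.support, Keep Ψ) → (∀ Ψ ∈ y.support, Res Ψ ∨ P Ψ < k) →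
      ∃ y' : CMF G c →₀ ℤ, y - y' ∈ L ∧ (∀ Ψ ∈ y'.support, Keep Ψ) ∧ ∀ Ψ ∈ y'.support, Res Ψ by
    obtain ⟨K, hK⟩ := Finset.exists_le (y.support.image P)
    exact h (K + 1) y hyK fun Ψ hΨ => Or.inr (Nat.lt_succ_of_le (hK _ (Finset.mem_image_of_mem P hΨ)))
  intro k
  induction k with
  | zero =>
    intro y hyK hy
    exact ⟨y, by rw [sub_self]; exact Submodule.zero_mem _, hyK, fun Ψ hΨ => (hy Ψ hΨ).resolve_right (Nat.not_lt_zero _)⟩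
  | succ k ih =>
    intro y hyK hy
    obtain ⟨y₁, h₁, hy₁K, hy₁⟩ := tracked_clear_step P Res Keep L hL k y hyK hy
    obtain ⟨y₂, h₂, hy₂K, hy₂⟩ := ih y₁ hy₁K hy₁
    exact ⟨y₂, by rw [show y - y₂ = (y - y₁) + (y₁ - y₂) from by abel]; exact Submodule.add_mem _ h₁ h₂, hy₂K, hy₂⟩

end Engine

/-! ## §3 The vanishing lemma -/

/-- A type is determined by its two restrictions. [folklore] -/
theorem eq_of_res_eq (hcH : c ∈ H) (hcen : ∀ g : G, g * c = c * g) (hH : H.index = 2) {x : G} (hx : x ∉ H) {Θ Θ' : CMF G c}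
    (h0 : res₀ hcH Θ = res₀ hcH Θ') (h1 : res₁ hcH hcen x Θ = res₁ hcH hcen x Θ') : Θ = Θ' :=
  ext_of_res hcH hcen hH hx h0 h1

/-- **THE VANISHING LEMMA.**  Fix a base type `T₀` of `(H, c)` and a CANONICAL DEVIATION `κ a ∈ T₀ ∖ a` for every type `a ≠ T₀`.  A vector with
`marg₀ = marg₁ = 0` supported on DIAGONAL types (`res₁ = res₀`) and CANONICAL DOWN-ARCS (`res₁ = (res₀)^{(κ res₀)}`, `res₀ ≠ T₀`) is `0`.
(Take a type in the support whose `0`-coordinate `a` is heaviest: the in-flow at `a` is the diagonal coefficient alone — an arc into `a` starts at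
a heavier vertex — so it vanishes; then the out-flow at `a` is the canonical arc coefficient alone, which vanishes too.) [folklore] -/
theorem eq_zero_of_supported_canonical (hcH : c ∈ H) (hcen : ∀ g : G, g * c = c * g) (hc2 : c * c = 1) (hH : H.index = 2) {x : G} (hx : x ∉ H)
    (T₀ : CMF H ⟨c, hcH⟩) (κ : CMF H ⟨c, hcH⟩ → H) (hκ : ∀ a : CMF H ⟨c, hcH⟩, a ≠ T₀ → κ a ∈ T₀.1 ∧ κ a ∉ a.1)
    {z : CMF G c →₀ ℤ} (hz0 : marg₀ hcH z = 0) (hz1 : marg₁ hcH hcen x z = 0)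
    (hsupp : ∀ Θ ∈ z.support, res₁ hcH hcen x Θ = res₀ hcH Θ ∨
      (res₀ hcH Θ ≠ T₀ ∧ res₁ hcH hcen x Θ = oflipCM (⟨c, hcH⟩ : H) (csub_mul_csub hcH hc2) (κ (res₀ hcH Θ)) (res₀ hcH Θ))) :
    z = 0 := by
  classical
  have hc2' := csub_mul_csub hcH hc2
  by_contra hz
  have hne : z.support.Nonempty := Finsupp.support_nonempty_iff.mpr hz
  -- a type in the support with heaviest `0`-coordinate
  obtain ⟨Θ, hΘ, hmax⟩ := Finset.exists_max_image z.support (fun Θ => wt (⟨c, hcH⟩ : H) T₀ (res₀ hcH Θ)) hne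
  set a := res₀ hcH Θ with ha
  -- weights: a canonical down-arc from `a'` ends at a type lighter than `a'`
  have hdown : ∀ a' : CMF H ⟨c, hcH⟩, a' ≠ T₀ →
      wt (⟨c, hcH⟩ : H) T₀ (oflipCM (⟨c, hcH⟩ : H) hc2' (κ a') a') + 1 = wt (⟨c, hcH⟩ : H) T₀ a' := fun a' ha' =>
    wt_oflipCM_of_notMem _ hc2' (hκ a' ha').1 (hκ a' ha').2
  -- (1) the in-flow at `a`: only the diagonal type `(a, a)` contributes
  have hin : ∀ Θ' ∈ z.support, res₁ hcH hcen x Θ' = a → res₀ hcH Θ' = a := by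
    intro Θ' hΘ' h1
    rcases hsupp Θ' hΘ' with hdiag | ⟨hne', hcan⟩
    · rw [← hdiag, h1]
    · -- an arc into `a` starts at a heavier vertex: impossible
      exfalso
      have hw := hdown _ hne'
      rw [← hcan, h1] at hw
      have hle := hmax Θ' hΘ'
      omega
  let Δ : CMF G c := glue hcH hcen hH hx a a
  have hΔ0 : res₀ hcH Δ = a := res₀_glue hcH hcen hH hx a a
  have hΔ1 : res₁ hcH hcen x Δ = a := res₁_glue hcH hcen hH hx a a
  -- (2) the diagonal coefficient at `a` vanishes (in-flow condition)
  have hzΔ : z Δ = 0 := by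
    have h := congrArg (fun f => f a) hz1
    simp only [Finsupp.coe_zero, Pi.zero_apply, marg₁_apply_eq_sum] at h
    rw [Finset.sum_eq_single Δ (fun Θ' hΘ' hne' => ?_) (fun hΔ => ?_), if_pos hΔ1] at h
    · exact h
    · rw [if_neg]
      intro h1
      exact hne' (eq_of_res_eq hcH hcen hH hx (by rw [hin Θ' hΘ' h1, hΔ0]) (by rw [h1, hΔ1]))
    · rw [Finsupp.notMem_support_iff.mp hΔ, if_pos hΔ1]
  rcases hsupp Θ hΘ with hdiag | ⟨haT, hcan⟩
  · -- `Θ` is the diagonal type `(a, a)`: contradiction with (2)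
    have hΘΔ : Θ = Δ := eq_of_res_eq hcH hcen hH hx (by rw [hΔ0]) (by rw [hdiag, hΔ1])
    exact (Finsupp.mem_support_iff.mp hΘ) (by rw [hΘΔ]; exact hzΔ)
  · -- `Θ` is the canonical down-arc from `a`: the out-flow condition kills its coefficient
    have h := congrArg (fun f => f a) hz0
    simp only [Finsupp.coe_zero, Pi.zero_apply, marg₀_apply_eq_sum] at h
    rw [Finset.sum_eq_single Θ (fun Θ' hΘ' hne' => ?_) (fun hΘS => absurd hΘ hΘS), if_pos ha.symm] at h
    · exact (Finsupp.mem_support_iff.mp hΘ) h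
    · by_cases h0 : res₀ hcH Θ' = a
      · rw [if_pos h0]
        rcases hsupp Θ' hΘ' with hdiag' | ⟨-, hcan'⟩
        · -- diagonal at `a`: coefficient `z Δ = 0`
          have hΘ'Δ : Θ' = Δ := eq_of_res_eq hcH hcen hH hx (by rw [h0, hΔ0]) (by rw [hdiag', h0, hΔ1])
          rw [hΘ'Δ]; exact hzΔ
        · -- canonical arc from `a`: it is `Θ` itself
          exfalso
          refine hne' (eq_of_res_eq hcH hcen hH hx (by rw [h0, ha]) ?_)
          rw [hcan', hcan, h0]
      · rw [if_neg h0]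

end

end Summit.HodgeConjecture.CorCM.Census.IndexTwoDescent
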